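import Summits.MatrixMultiplication.MatrixMultiplication.Theorems.SoloBlindHypergraphThree

/-!
# (K₃) at every target with at most three representations

Sub-programme (K₃).  `SoloBlindHypergraphThree` proved Conjecture E unconditionally at every H-good target with at
most three representations (`soloBlind_conjE_of_card_repAll_le_three`).  The cone lift (`SoloBlindConeLift`:
`h ↦ S × 0 ∪ {(0,1)} ⊂ G × ℤ/3`) makes every target H-good, halves the Kraft mass (`soloBlind_cone_mass`) and
preserves the NUMBER of representations (`soloBlind_cone_repAll`: they are the sets `insertNone T`).  Hence the
full Kraft inequality (K₃) `soloBlindMass h S σ ≤ 1` holds UNCONDITIONALLY at every target `σ` with at most three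
representations of a zero-sum-free `h` in a group of exponent `3`, in every rank
(`soloBlind_kraft_of_card_repAll_le_three`).
-/

namespace Summit.MatrixMultiplication.MatrixMultiplication.Theorems

open Finset

universe u v

variable {ι : Type v} [DecidableEq ι]
variable {G : Type u} [AddCommGroup G] [DecidableEq G]

omit [DecidableEq ι] in
/-- The cone target `(σ, 1)` has as many representations as `σ`. -/
theorem soloBlind_cone_repAll_card (h : ι → G) (S : Finset ι) (σ : G) :
    (soloBlindSeqRepAll (soloBlindCone h) (insertNone S) ((σ, 1) : G × ZMod 3)).card =
      (soloBlindSeqRepAll h S σ).card := by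
  rw [soloBlind_cone_repAll, Finset.card_map]

/-- (K₃) AT TARGETS WITH AT MOST THREE REPRESENTATIONS (unconditional, every rank): for `h` zero-sum free on `S` in
a group of exponent `3` and a target `σ` with at most three representations, `soloBlindMass h S σ ≤ 1`. -/
theorem soloBlind_kraft_of_card_repAll_le_three (three : ∀ g : G, g + g + g = 0) (h : ι → G) (S : Finset ι)
    (zsf : ∀ T ⊆ S, T.Nonempty → ∑ i ∈ T, h i ≠ 0) (σ : G) (hN : (soloBlindSeqRepAll h S σ).card ≤ 3) :
    soloBlindMass h S σ ≤ 1 := by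
  have hcone := soloBlind_conjE_of_card_repAll_le_three (soloBlind_cone_three three) (soloBlindCone h)
    (insertNone S) ((σ, 1) : G × ZMod 3) (soloBlind_cone_zsf zsf) (soloBlind_cone_hgood h S σ)
    (by rw [soloBlind_cone_repAll_card]; exact hN)
  rw [soloBlind_cone_mass] at hcone
  linarith

/-- The same at targets with at most two representations, from the two-vertex case. -/
theorem soloBlind_kraft_of_card_repAll_le_two (three : ∀ g : G, g + g + g = 0) (h : ι → G) (S : Finset ι)
    (zsf : ∀ T ⊆ S, T.Nonempty → ∑ i ∈ T, h i ≠ 0) (σ : G) (hN : (soloBlindSeqRepAll h S σ).card ≤ 2) :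
    soloBlindMass h S σ ≤ 1 :=
  soloBlind_kraft_of_card_repAll_le_three three h S zsf σ (hN.trans (by norm_num))

end Summit.MatrixMultiplication.MatrixMultiplication.Theorems
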